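import Summits.ResolutionOfSingularities.ResolutionOfSingularities.Theorems.WeightedInvariantWeightedConstructionExceptionalSmooth
import Summits.ResolutionOfSingularities.ResolutionOfSingularities.Theorems.WeightedInvariantWeightedConstructionCobordantPlusSmoothOfRegular
import Summits.ResolutionOfSingularities.ResolutionOfSingularities.Theorems.WeightedInvariantWeightedConstructionExtReesWeighted
import Summits.ResolutionOfSingularities.ResolutionOfSingularities.Theorems.WeightedInvariantWeightedConstructionCobordantBlowupRegular
import Literature.AlgebraicGeometry.Resolution.WeightedResolutionDatum
import Literature.AlgebraicGeometry.Resolution.SmoothOfRegularPerfectField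
import Literature.AlgebraicGeometry.Resolution.SmoothStalksRegular
import Literature.AlgebraicGeometry.Resolution.ProjectiveSpaceRegular
import Mathlib.AlgebraicGeometry.Morphisms.Smooth
import Mathlib.AlgebraicGeometry.Morphisms.Separated
import Mathlib.AlgebraicGeometry.Morphisms.QuasiCompact
import Mathlib.AlgebraicGeometry.Morphisms.FiniteType
import Mathlib.AlgebraicGeometry.Morphisms.Affine
import Mathlib.AlgebraicGeometry.Morphisms.ClosedImmersion
import Mathlib.AlgebraicGeometry.Noetherian
import HarnessLib

/-!
# The full cobordant blow-up `B(U) → Spec k` of a weighted chart and its exceptional divisor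
# `V(t⁻¹) → Spec k` are smooth, separated and quasi-compact

Route `ResolutionOfSingularities/WeightedInvariant`, crux `WeightedConstruction`
(stmt-ResolutionOfSingularities-0571), line `no-phi-rays-static-drop`, stub
`stub_fullBlowup_regime`.

For a Rees algebra `R` on a smooth separated quasi-compact scheme `Y` over a perfect field `k`,
presented on the affine open `U` by a weighted chart `(u, w)` (`ReesAlgebraData.IsWeightedChart`),
write `A := Γ(Y, U)` and `S := A[t⁻¹, Rₙ(U) tⁿ]` (`extReesAlgebra (R.chartIdeals U)`), so that the
FULL cobordant blow-up of the chart is `B(U) = Spec S` (Włodarczyk, *Functorial resolution by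
torus actions*, arXiv:2203.03090, Def. 2.3.5) with structure morphism
`B(U) → Spec A ≅ U ↪ Y → Spec k`, and `V(t⁻¹) ⊆ B(U)` is the closed subscheme of the exceptional
ideal sheaf `(t⁻¹)`.

* `Y` is smooth over a field, hence regular and locally Noetherian; on the weighted chart
  `S = A[t⁻¹, uᵢ t^{wᵢ}]` (`stub_extReesAlgebra_weighted`) is a regular ring
  (Włodarczyk §2.3.9, `isRegularRing_cobordantAlgebra_of_isWeightedChart`) of finite type over `A`
  (`finiteType_cobordantAlgebra`), so `B(U)` is a regular scheme, locally of finite type over the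
  perfect field `k`, hence smooth (`smooth_of_isRegular_of_perfectField`); it is separated over
  `k` (a morphism of affine schemes, an open immersion and the separated `f`) and quasi-compact
  (its source `Spec S` is a Noetherian space).
* `S/(t⁻¹) ≅ (A/(u))[u']` is regular (Lemma 4.1.5,
  `isRegularRing_cobordantAlgebra_quotient_span_s_of_isWeightedChart`,
  `isRegularRing_extReesAlgebra_quotient_of_eq`), so the closed subscheme `V(t⁻¹) ⊆ B(U)` is
  regular (`isRegular_subscheme_exceptional`); `V(t⁻¹) ↪ B(U)` is a closed immersion, so
  `V(t⁻¹) → Spec k` is locally of finite type (hence smooth), separated and quasi-compact.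

Source: J. Włodarczyk, *Functorial resolution by torus actions*, arXiv:2203.03090, §2.3.9 and
Lemma 4.1.5. [Wlodarczyk2022]
-/

noncomputable section

open CategoryTheory CategoryTheory.Limits AlgebraicGeometry TopologicalSpace
open Literature.AlgebraicGeometry.Resolution
open scoped LaurentPolynomial

set_option linter.dupNamespace false -- mandated namespace of this single-conjunct summit

namespace Summit.ResolutionOfSingularities.ResolutionOfSingularities.Theorems

universe u

/-! ## The ring of the full cobordant blow-up of a weighted chart -/

/-- On a weighted chart the extended Rees algebra `A[t⁻¹, Iₙ tⁿ]` of the pieces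
`Iₙ = (u^α : Σ wᵢ αᵢ ≥ n)` is `A[t⁻¹, uᵢ t^{wᵢ}]` (`stub_extReesAlgebra_weighted`), so it is a
regular ring as soon as `A[t⁻¹, uᵢ t^{wᵢ}]` is. [folklore] -/
theorem isRegularRing_extReesAlgebra_of_eq {A : Type} [CommRing A] {I : ℕ → Ideal A} {m : ℕ}
    {u : Fin m → A} {w : Fin m → ℕ} (hI : I = weightedMonomialIdeal u w)
    [hreg : IsRegularRing (cobordantAlgebra u w)] : IsRegularRing (extReesAlgebra I) := by
  subst hI
  -- the `A`-isomorphism `A[t⁻¹, uᵢ t^{wᵢ}] ≅ A[t⁻¹, Iₙ tⁿ]` of equal subalgebras of `A[t, t⁻¹]`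
  let e : cobordantAlgebra u w ≃ₐ[A] extReesAlgebra (weightedMonomialIdeal u w) :=
    Subalgebra.equivOfEq _ _ (stub_extReesAlgebra_weighted u w).symm
  exact IsRegularRing.of_ringEquiv (R := cobordantAlgebra u w) e.toRingEquiv

/-- On a weighted chart the extended Rees algebra `A[t⁻¹, Iₙ tⁿ] = A[t⁻¹, uᵢ t^{wᵢ}]` is of
finite type over `A` (`finiteType_cobordantAlgebra`, Włodarczyk §2.3.9). [folklore] -/
theorem finiteType_extReesAlgebra_of_eq {A : Type} [CommRing A] {I : ℕ → Ideal A} {m : ℕ}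
    {u : Fin m → A} {w : Fin m → ℕ} (hI : I = weightedMonomialIdeal u w) :
    Algebra.FiniteType A (extReesAlgebra I) := by
  subst hI
  let e : cobordantAlgebra u w ≃ₐ[A] extReesAlgebra (weightedMonomialIdeal u w) :=
    Subalgebra.equivOfEq _ _ (stub_extReesAlgebra_weighted u w).symm
  haveI := finiteType_cobordantAlgebra u w
  exact Algebra.FiniteType.equiv this e

/-! ## Morphism properties of `B = Spec A[t⁻¹, Iₙ tⁿ] → Spec A` -/

section Affine

variable {A : Type u} [CommRing A] (I : ℕ → Ideal A)

/-- The projection `B = Spec A[t⁻¹, Iₙ tⁿ] → Spec A` is separated (a morphism of affine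
schemes). [folklore] -/
theorem affineCobordantBlowup_π_isSeparated : IsSeparated (affineCobordantBlowup.π I) :=
  (inferInstance :
    IsSeparated (Spec.map (CommRingCat.ofHom (algebraMap A (extReesAlgebra I)))))

/-- If `A[t⁻¹, Iₙ tⁿ]` is of finite type over `A`, the projection `B → Spec A` is locally of
finite type. [folklore] -/
theorem affineCobordantBlowup_π_locallyOfFiniteType
    (hft : Algebra.FiniteType A (extReesAlgebra I)) :
    LocallyOfFiniteType (affineCobordantBlowup.π I) :=
  (HasRingHomProperty.Spec_iff (P := @LocallyOfFiniteType)).mpr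
    (show (CommRingCat.ofHom (algebraMap A (extReesAlgebra I))).hom.FiniteType from
      RingHom.finiteType_algebraMap.mpr hft)

/-- If `A[t⁻¹, Iₙ tⁿ]` is a regular ring, `B = Spec A[t⁻¹, Iₙ tⁿ]` is a regular scheme.
[folklore] -/
theorem affineCobordantBlowup_isRegular [IsRegularRing (extReesAlgebra I)] :
    Scheme.IsRegular (affineCobordantBlowup I) := by
  haveI : IsRegularRing (CommRingCat.of (extReesAlgebra I)) := ‹_›
  exact Scheme.isRegular_Spec (.of (extReesAlgebra I))

/-- If `A[t⁻¹, Iₙ tⁿ]` is a Noetherian ring, the underlying space of `B = Spec A[t⁻¹, Iₙ tⁿ]` is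
Noetherian. [folklore] -/
theorem affineCobordantBlowup_noetherianSpace [IsNoetherianRing (extReesAlgebra I)] :
    NoetherianSpace (affineCobordantBlowup I) := by
  haveI : IsNoetherianRing (CommRingCat.of (extReesAlgebra I)) := ‹_›
  exact (inferInstance : NoetherianSpace (Spec (CommRingCat.of (extReesAlgebra I))))

end Affine

/-! ## The stub -/

/-- **On a weighted chart, `B(U) → Spec k` and `V(t⁻¹) → Spec k` are smooth, separated and
quasi-compact** (registered stub `stub_fullBlowup_regime` of line `no-phi-rays-static-drop`): for
a Rees algebra presented by a weighted chart `(u, w)` on the affine open `U` of a smooth separated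
quasi-compact `Y` over a perfect field, the FULL cobordant blow-up
`B(U) = Spec Γ(U)[t⁻¹, uᵢ t^{wᵢ}]` is regular of finite type over `Γ(U)` (Włodarczyk 2.3.9,
`isRegularRing_cobordantAlgebra_of_isWeightedChart`) and its exceptional divisor
`V(t⁻¹) = Spec (Γ(U)/(u))[u']` is regular (Lemma 4.1.5, `isRegular_subscheme_exceptional`);
regular + locally of finite type over a perfect field ⇒ smooth
(`smooth_of_isRegular_of_perfectField`); affine / closed immersion ⇒ separated and
quasi-compact. [cite: Wlodarczyk2022, §2.3.9 and Lemma 4.1.5] -/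
theorem stub_fullBlowup_regime :
    ∀ ⦃k : Type⦄ [Field k] [PerfectField k] ⦃Y : Scheme.{0}⦄ (f : Y ⟶ Spec (.of k)) [Smooth f]
      [IsSeparated f] [QuasiCompact f] (R : ReesAlgebraData Y) (U : Y.affineOpens),
      (∃ (m : ℕ) (u : Fin m → Γ(Y, U)) (w : Fin m → ℕ), R.IsWeightedChart U u w) →
      Smooth (affineCobordantBlowup.π (R.chartIdeals U) ≫ U.2.fromSpec ≫ f) ∧
      IsSeparated (affineCobordantBlowup.π (R.chartIdeals U) ≫ U.2.fromSpec ≫ f) ∧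
      QuasiCompact (affineCobordantBlowup.π (R.chartIdeals U) ≫ U.2.fromSpec ≫ f) ∧
      Smooth ((affineCobordantBlowup.exceptional (R.chartIdeals U)).subschemeι ≫
        affineCobordantBlowup.π (R.chartIdeals U) ≫ U.2.fromSpec ≫ f) ∧
      IsSeparated ((affineCobordantBlowup.exceptional (R.chartIdeals U)).subschemeι ≫
        affineCobordantBlowup.π (R.chartIdeals U) ≫ U.2.fromSpec ≫ f) ∧
      QuasiCompact ((affineCobordantBlowup.exceptional (R.chartIdeals U)).subschemeι ≫
        affineCobordantBlowup.π (R.chartIdeals U) ≫ U.2.fromSpec ≫ f) := by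
  intro k _ _ Y f _ _ _ R U hchart
  obtain ⟨m, u, w, hc⟩ := hchart
  -- `Y` is regular and locally Noetherian
  haveI : IsLocallyNoetherian Y := LocallyOfFiniteType.isLocallyNoetherian f
  have hY : Scheme.IsRegular Y := fun y => isRegularLocalRing_stalk_of_smooth_of_field f y
  -- on the chart, `Γ(U)[t⁻¹, Rₙ(U) tⁿ] = Γ(U)[t⁻¹, uᵢ t^{wᵢ}]` is regular of finite type
  have hI : R.chartIdeals U = weightedMonomialIdeal u w := funext fun n => hc.ideal_eq n
  haveI := isRegularRing_cobordantAlgebra_of_isWeightedChart hY hc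
  haveI hreg : IsRegularRing (extReesAlgebra (R.chartIdeals U)) :=
    isRegularRing_extReesAlgebra_of_eq hI
  have hft : Algebra.FiniteType Γ(Y, U) (extReesAlgebra (R.chartIdeals U)) :=
    finiteType_extReesAlgebra_of_eq hI
  -- and its exceptional fibre ring `Γ(U)[t⁻¹, Rₙ(U) tⁿ]/(t⁻¹)` is regular
  haveI := isRegularRing_cobordantAlgebra_quotient_span_s_of_isWeightedChart hY hc
  haveI := isRegularRing_extReesAlgebra_quotient_of_eq hI
  -- the pieces `B(U) → Spec Γ(Y, U)` and `Spec Γ(Y, U) ≅ U ↪ Y`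
  haveI : IsSeparated (affineCobordantBlowup.π (R.chartIdeals U)) :=
    affineCobordantBlowup_π_isSeparated _
  haveI : LocallyOfFiniteType (affineCobordantBlowup.π (R.chartIdeals U)) :=
    affineCobordantBlowup_π_locallyOfFiniteType _ hft
  have hsepU : IsSeparated U.2.fromSpec := inferInstance
  have hftU : LocallyOfFiniteType U.2.fromSpec := inferInstance
  -- the structure morphism `B(U) → Spec k` is separated and locally of finite type
  haveI hsep : IsSeparated (affineCobordantBlowup.π (R.chartIdeals U) ≫ U.2.fromSpec ≫ f) :=
    MorphismProperty.comp_mem @IsSeparated _ _ ‹_›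
      (MorphismProperty.comp_mem @IsSeparated _ _ hsepU inferInstance)
  haveI hlft : LocallyOfFiniteType (affineCobordantBlowup.π (R.chartIdeals U) ≫ U.2.fromSpec ≫ f) :=
    MorphismProperty.comp_mem @LocallyOfFiniteType _ _ ‹_›
      (MorphismProperty.comp_mem @LocallyOfFiniteType _ _ hftU inferInstance)
  -- `B(U)` is regular with Noetherian underlying space, hence smooth and quasi-compact over `k`
  have hB : Scheme.IsRegular (affineCobordantBlowup (R.chartIdeals U)) :=
    affineCobordantBlowup_isRegular (R.chartIdeals U)
  haveI : NoetherianSpace (affineCobordantBlowup (R.chartIdeals U)) :=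
    affineCobordantBlowup_noetherianSpace (R.chartIdeals U)
  haveI hqc : QuasiCompact (affineCobordantBlowup.π (R.chartIdeals U) ≫ U.2.fromSpec ≫ f) :=
    quasiCompact_of_noetherianSpace_source _
  have hsm : Smooth (affineCobordantBlowup.π (R.chartIdeals U) ≫ U.2.fromSpec ≫ f) :=
    smooth_of_isRegular_of_perfectField _ hB
  -- `V(t⁻¹) ⊆ B(U)` is regular, and `V(t⁻¹) ↪ B(U)` is a closed immersion
  have hE : Scheme.IsRegular (affineCobordantBlowup.exceptional (R.chartIdeals U)).subscheme :=
    isRegular_subscheme_exceptional (R.chartIdeals U)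
  haveI hlftE : LocallyOfFiniteType
      ((affineCobordantBlowup.exceptional (R.chartIdeals U)).subschemeι ≫
        affineCobordantBlowup.π (R.chartIdeals U) ≫ U.2.fromSpec ≫ f) :=
    MorphismProperty.comp_mem @LocallyOfFiniteType _ _ inferInstance hlft
  have hsepE : IsSeparated
      ((affineCobordantBlowup.exceptional (R.chartIdeals U)).subschemeι ≫
        affineCobordantBlowup.π (R.chartIdeals U) ≫ U.2.fromSpec ≫ f) :=
    MorphismProperty.comp_mem @IsSeparated _ _ inferInstance hsep
  have hqcE : QuasiCompact
      ((affineCobordantBlowup.exceptional (R.chartIdeals U)).subschemeι ≫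
        affineCobordantBlowup.π (R.chartIdeals U) ≫ U.2.fromSpec ≫ f) :=
    MorphismProperty.comp_mem @QuasiCompact _ _ inferInstance hqc
  exact ⟨hsm, hsep, hqc, smooth_of_isRegular_of_perfectField _ hE, hsepE, hqcE⟩

end Summit.ResolutionOfSingularities.ResolutionOfSingularities.Theorems

end
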